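import Mathlib.Algebra.MvPolynomial.PDeriv
import Mathlib.Data.Finsupp.Antidiagonal
import Mathlib.LinearAlgebra.Dimension.Constructions
import Mathlib.LinearAlgebra.Dimension.Finite
import Mathlib.LinearAlgebra.Matrix.Determinant.Basic
import Literature.Computability.AlgebraicComplexity.FormulaUnfolding

/-!
# Route BarrierLever — the MODEL axis of item `SingleSizeEquations` (stmt-ValiantsHypothesis-8749):
# Kalorkoti's formula-size measure read at the origin (part 1/2: the rank bound for formulas)

Kalorkoti (SIAM J. Comput. 14 (1985)) bounds the transcendence degree of the coefficients of `f`,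
viewed as a polynomial in one block of variables, by the number of leaves of that block in any
formula for `f`.  Read AT THE ORIGIN the method is a plain rank condition on the coefficient
vector — a closed, determinantal, hence algebraically natural (Forbes–Shpilka–Volk) condition:
for a variable `y`, columns `w : ι → σ` avoiding `y` and `j : ℕ`, the **Kalorkoti row**
`krow y w j f : ι → F` is `l ↦ coeff (y^j) (∂f/∂(w l))` = the coefficient of `y^j · (w l)` in `f`
(`krow_apply_eq_coeff`).

THEOREM (`WExpr.exists_leafCount_krow_mem_span`).  Every fan-in-two weighted formula `e` (tree
`WExpr`, bridge `exists_wexpr_iff_formulaComplexity_le`) has a leaf count `d : σ → ℕ`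
(`∑_{y ∈ s} d y ≤ e.numVars`) such that for every `y` and every `w` avoiding `y` the rows
`krow y w j e.eval`, `j ≥ 1`, lie in the span of at most `4 · d y` vectors; hence
(`det_eq_zero_of_rows_mem_span`) every square matrix of such rows with more than `4 · d y` rows is
singular.  Mechanism (`KInv`, Kalorkoti's invariant linearised): a formula with `s ≥ 1` leaves
labelled `y` computes `A · Ψ + B` with `A, B` free of `y` and ALL rows of `Ψ` in the span of
`≤ 4s - 4` vectors; a sum node costs `≤ 3` generators, a product node `≤ 4` (`KInv.lin`,
`KInv.mul`); the product rule for rows (`krow_mul`) is Leibniz for `∂/∂(w l)` plus `coeff_mul`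
on the antidiagonal of `single y j`.  Linear algebra only (no transcendence degree, no Jacobian
criterion).  Part 2 (`…FormulaSliceEquations.lean`) packages the `poly(N)`-size distinguisher.
WHAT THIS IS NOT: nothing about general circuits (size axis of 8745/8749 stays at `b ≤ 1` and
linear sizes), about 8745/8749 themselves (Chatterjee–Tengse 2023 §1.3 dir. 2, open) or VP vs VNP.
References: Kalorkoti 1985; Bürgisser–Clausen–Shokrollahi 1997 §21.1; Forbes–Shpilka–Volk 2018.
-/

-- layout Summits/ValiantsHypothesis/ValiantsHypothesis forces the duplicated namespace component
set_option linter.dupNamespace false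

noncomputable section

open MvPolynomial Finsupp

namespace Summit.ValiantsHypothesis.ValiantsHypothesis.Theorems.BarrierLever.FormulaSlice

open Literature.Computability.AlgebraicComplexity

universe u v w

variable {F : Type u} [Field F] {σ : Type v} {ι : Type w}

/-! ## Kalorkoti rows, `y`-free polynomials, rows in a span -/

/-- The **Kalorkoti row** of `P` for the block variable `y`, columns `w : ι → σ` and exponent `j`:
`l ↦ coeff (y^j) (∂P/∂(w l))`; for `w l ≠ y` this is the coefficient of the monomial `y^j · w l`
in `P` (`krow_apply_eq_coeff`).  Kalorkoti's transcendence-degree measure read at the origin.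
[cite: Kalorkoti1985, §2] -/
def krow (y : σ) (w : ι → σ) (j : ℕ) (P : MvPolynomial σ F) : ι → F :=
  fun l => coeff (Finsupp.single y j) (pderiv (w l) P)

/-- `P` is free of the variable `y`: no monomial of its support involves `y`. [folklore] -/
def YFree (y : σ) (P : MvPolynomial σ F) : Prop :=
  ∀ m ∈ P.support, m y = 0

/-- All Kalorkoti rows of `P` (every exponent `j ≥ 0`) lie in the span of `S`. [folklore] -/
def RowsIn (y : σ) (w : ι → σ) (S : Set (ι → F)) (P : MvPolynomial σ F) : Prop :=
  ∀ j, krow y w j P ∈ Submodule.span F S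

section rows

variable (y : σ) (w : ι → σ)

/-- Unfolding of a Kalorkoti row entry. [cite: Kalorkoti1985, §2] -/
theorem krow_apply (j : ℕ) (P : MvPolynomial σ F) (l : ι) :
    krow y w j P l = coeff (Finsupp.single y j) (pderiv (w l) P) := rfl

/-- For a column variable `w l ≠ y`, the row entry is the coefficient of `y^j · (w l)`.
[cite: Kalorkoti1985, §2] -/
theorem krow_apply_eq_coeff {j : ℕ} {l : ι} (hl : w l ≠ y) (P : MvPolynomial σ F) :
    krow y w j P l = coeff (Finsupp.single y j + Finsupp.single (w l) 1) P := by
  classical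
  rw [krow_apply, coeff_pderiv, Finsupp.single_apply, if_neg hl.symm]
  simp

/-- Rows are additive. [folklore] -/
theorem krow_add (j : ℕ) (P Q : MvPolynomial σ F) :
    krow y w j (P + Q) = krow y w j P + krow y w j Q := by
  funext l
  simp [krow_apply, map_add, coeff_add]

/-- Rows are homogeneous. [folklore] -/
theorem krow_smul (j : ℕ) (c : F) (P : MvPolynomial σ F) :
    krow y w j (c • P) = c • krow y w j P := by
  funext l
  simp [krow_apply, (pderiv (w l)).map_smul, coeff_smul]

/-- **Product rule for Kalorkoti rows** (Leibniz for `∂/∂(w l)`, then `coeff_mul` on the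
antidiagonal of `single y j`):
`row_j(PQ) = Σ_{a+b=j} (coeff(y^b) Q · row_a(P) + coeff(y^a) P · row_b(Q))`. [folklore] -/
theorem krow_mul (j : ℕ) (P Q : MvPolynomial σ F) :
    krow y w j (P * Q) = ∑ x ∈ Finset.HasAntidiagonal.antidiagonal j,
      (coeff (Finsupp.single y x.2) Q • krow y w x.1 P +
        coeff (Finsupp.single y x.1) P • krow y w x.2 Q) := by
  classical
  funext l
  rw [krow_apply, pderiv_mul, coeff_add, coeff_mul, coeff_mul, Finsupp.antidiagonal_single,
    Finset.sum_map, Finset.sum_map, ← Finset.sum_add_distrib, Finset.sum_apply]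
  refine Finset.sum_congr rfl fun x _ => ?_
  simp only [Function.Embedding.coe_prodMap, Function.Embedding.coeFn_mk, Prod.map_fst,
    Prod.map_snd, Pi.add_apply, Pi.smul_apply, smul_eq_mul, krow_apply]
  ring

variable {y w}

/-- Rows in a span: monotone in the generating set. [folklore] -/
theorem RowsIn.mono {S T : Set (ι → F)} (hST : S ⊆ T) {P : MvPolynomial σ F}
    (hP : RowsIn y w S P) : RowsIn y w T P :=
  fun j => Submodule.span_mono hST (hP j)

/-- Rows in a span: closed under weighted sums. [folklore] -/
theorem RowsIn.lin {S : Set (ι → F)} {P Q : MvPolynomial σ F} (hP : RowsIn y w S P)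
    (hQ : RowsIn y w S Q) (c₁ c₂ : F) : RowsIn y w S (c₁ • P + c₂ • Q) := by
  intro j
  rw [krow_add, krow_smul, krow_smul]
  exact Submodule.add_mem _ (Submodule.smul_mem _ _ (hP j)) (Submodule.smul_mem _ _ (hQ j))

/-- Rows in a span: closed under sums. [folklore] -/
theorem RowsIn.add {S : Set (ι → F)} {P Q : MvPolynomial σ F} (hP : RowsIn y w S P)
    (hQ : RowsIn y w S Q) : RowsIn y w S (P + Q) := by
  simpa using hP.lin hQ 1 1

/-- Rows in a span: products cost nothing beyond the union of the generating sets
(`krow_mul`). [folklore] -/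
theorem RowsIn.mul {S T : Set (ι → F)} {P Q : MvPolynomial σ F} (hP : RowsIn y w S P)
    (hQ : RowsIn y w T Q) : RowsIn y w (S ∪ T) (P * Q) := by
  intro j
  rw [krow_mul]
  refine Submodule.sum_mem _ fun x _ => Submodule.add_mem _ ?_ ?_
  · exact Submodule.smul_mem _ _ (Submodule.span_mono Set.subset_union_left (hP x.1))
  · exact Submodule.smul_mem _ _ (Submodule.span_mono Set.subset_union_right (hQ x.2))

/-- The block variable itself has ZERO rows when the columns avoid it:
`∂y/∂(w l) = 0`. [folklore] -/
theorem RowsIn.X_self (hw : ∀ l, w l ≠ y) : RowsIn y w (∅ : Set (ι → F)) (X y : MvPolynomial σ F) := by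
  classical
  intro j
  have h0 : krow y w j (X y : MvPolynomial σ F) = 0 := by
    funext l
    rw [krow_apply, pderiv_X, Pi.single_apply, if_neg (hw l).symm, coeff_zero]
    rfl
  rw [h0]
  exact Submodule.zero_mem _

end rows

/-! ## `y`-free polynomials -/

section yfree

variable {y : σ} {w : ι → σ}

/-- Constants are `y`-free. [folklore] -/
theorem YFree.C (y : σ) (c : F) : YFree y (C c : MvPolynomial σ F) := by
  classical
  intro m hm
  rw [MvPolynomial.mem_support_iff, coeff_C] at hm
  by_cases h : 0 = m
  · subst h; rfl
  · exact absurd (if_neg h) hm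

/-- Other variables are `y`-free. [folklore] -/
theorem YFree.X_of_ne {v : σ} (h : v ≠ y) : YFree y (X v : MvPolynomial σ F) := by
  classical
  intro m hm
  rw [MvPolynomial.support_X, Finset.mem_singleton] at hm
  subst hm
  rw [Finsupp.single_apply, if_neg h]

/-- `y`-free polynomials are closed under weighted sums. [folklore] -/
theorem YFree.lin {P Q : MvPolynomial σ F} (hP : YFree y P) (hQ : YFree y Q) (c₁ c₂ : F) :
    YFree y (c₁ • P + c₂ • Q) := by
  classical
  intro m hm
  have hm' := MvPolynomial.support_add hm
  rw [Finset.mem_union] at hm'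
  rcases hm' with h | h
  · exact hP m (MvPolynomial.support_smul h)
  · exact hQ m (MvPolynomial.support_smul h)

/-- `y`-free polynomials are closed under scalars. [folklore] -/
theorem YFree.smul {P : MvPolynomial σ F} (hP : YFree y P) (c : F) : YFree y (c • P) := by
  simpa using hP.lin hP c 0

/-- `y`-free polynomials are closed under products. [folklore] -/
theorem YFree.mul {P Q : MvPolynomial σ F} (hP : YFree y P) (hQ : YFree y Q) : YFree y (P * Q) := by
  classical
  intro m hm
  obtain ⟨a, ha, b, hb, rfl⟩ := Finset.mem_add.mp (MvPolynomial.support_mul P Q hm)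
  rw [Finsupp.add_apply, hP a ha, hQ b hb]

/-- A `y`-free polynomial has no coefficient at a monomial involving `y`. [folklore] -/
theorem YFree.coeff_eq_zero {P : MvPolynomial σ F} (hP : YFree y P) {m : σ →₀ ℕ} (hm : m y ≠ 0) :
    coeff m P = 0 := by
  by_contra h
  exact hm (hP m (MvPolynomial.mem_support_iff.mpr h))

/-- A `y`-free polynomial has zero Kalorkoti rows in every exponent `j ≥ 1`. [folklore] -/
theorem YFree.krow_succ {P : MvPolynomial σ F} (hP : YFree y P) (w : ι → σ) (j : ℕ) :
    krow y w (j + 1) P = 0 := by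
  classical
  funext l
  rw [krow_apply, coeff_pderiv, hP.coeff_eq_zero, zero_mul]
  · rfl
  · rw [Finsupp.add_apply, Finsupp.single_eq_same]
    omega

/-- A `y`-free polynomial has all its rows in the span of its `0`-th row. [folklore] -/
theorem YFree.rowsIn {P : MvPolynomial σ F} (hP : YFree y P) (w : ι → σ) :
    RowsIn y w ({krow y w 0 P} : Set (ι → F)) P := by
  intro j
  cases j with
  | zero => exact Submodule.subset_span rfl
  | succ j => rw [hP.krow_succ]; exact Submodule.zero_mem _

end yfree

/-! ## Kalorkoti's structural invariant -/

/-- **Kalorkoti's invariant** for a polynomial `P` computed with `s` leaves labelled `y`: either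
`s = 0` and `P` is `y`-free, or `P = A · Ψ + B` with `A, B` `y`-free and all Kalorkoti rows of `Ψ`
in the span of a finite set `G` with `|G| + 4 ≤ 4 s`. [cite: Kalorkoti1985, §3] -/
def KInv (y : σ) (w : ι → σ) (s : ℕ) (P : MvPolynomial σ F) : Prop :=
  (s = 0 ∧ YFree y P) ∨
    ∃ (G : Finset (ι → F)) (A B Ψ : MvPolynomial σ F), G.card + 4 ≤ 4 * s ∧
      YFree y A ∧ YFree y B ∧ RowsIn y w (G : Set (ι → F)) Ψ ∧ P = A * Ψ + B

section inv

variable {y : σ} {w : ι → σ}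

/-- A `y`-free polynomial satisfies the invariant with `s = 0`. [folklore] -/
theorem KInv.of_yFree {P : MvPolynomial σ F} (hP : YFree y P) : KInv y w 0 P :=
  Or.inl ⟨rfl, hP⟩

/-- The leaf `y` satisfies the invariant with `s = 1`: `y = 1 · y + 0`, no generators.
[cite: Kalorkoti1985, §3] -/
theorem KInv.X_self (hw : ∀ l, w l ≠ y) : KInv y w 1 (X y : MvPolynomial σ F) := by
  classical
  refine Or.inr ⟨∅, 1, 0, X y, by simp, ?_, ?_, ?_, by ring⟩
  · simpa using YFree.C (F := F) y 1
  · simpa using YFree.C (F := F) y 0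
  · simpa using RowsIn.X_self (F := F) hw

/-- Rows of `A · Ψ + B` for `y`-free `A, B`: the generators of `Ψ` plus the `0`-th rows of
`A` and `B`. [folklore] -/
theorem RowsIn.affine {S T : Set (ι → F)} {A B Ψ : MvPolynomial σ F} (hΨ : RowsIn y w S Ψ)
    (hA : YFree y A) (hB : YFree y B) (hS : S ⊆ T) (hA0 : krow y w 0 A ∈ T)
    (hB0 : krow y w 0 B ∈ T) : RowsIn y w T (A * Ψ + B) := by
  refine (((hA.rowsIn w).mul hΨ).mono ?_).add ((hB.rowsIn w).mono ?_)
  · rintro v (hv | hv)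
    · rw [Set.mem_singleton_iff] at hv
      exact hv ▸ hA0
    · exact hS hv
  · intro v hv
    rw [Set.mem_singleton_iff] at hv
    exact hv ▸ hB0

/-- Merging two instances of the second alternative of `KInv`: four new generators.
[cite: Kalorkoti1985, §3] -/
private theorem KInv.merge [DecidableEq (ι → F)] {s₁ s₂ : ℕ} {G₁ G₂ : Finset (ι → F)}
    {A₁ B₁ Ψ₁ A₂ B₂ Ψ₂ : MvPolynomial σ F} (hc₁ : G₁.card + 4 ≤ 4 * s₁)
    (hc₂ : G₂.card + 4 ≤ 4 * s₂) (hA₁ : YFree y A₁) (hB₁ : YFree y B₁)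
    (hΨ₁ : RowsIn y w (G₁ : Set (ι → F)) Ψ₁) (hA₂ : YFree y A₂) (hB₂ : YFree y B₂)
    (hΨ₂ : RowsIn y w (G₂ : Set (ι → F)) Ψ₂) :
    ∃ G : Finset (ι → F), G.card + 4 ≤ 4 * (s₁ + s₂) ∧
      RowsIn y w (G : Set (ι → F)) (A₁ * Ψ₁ + B₁) ∧ RowsIn y w (G : Set (ι → F)) (A₂ * Ψ₂ + B₂) := by
  refine ⟨G₁ ∪ G₂ ∪ {krow y w 0 A₁, krow y w 0 B₁, krow y w 0 A₂, krow y w 0 B₂}, ?_, ?_, ?_⟩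
  · have h1 : ({krow y w 0 A₁, krow y w 0 B₁, krow y w 0 A₂, krow y w 0 B₂} :
        Finset (ι → F)).card ≤ 4 := Finset.card_le_four
    have h2 := Finset.card_union_le G₁ G₂
    have h3 := Finset.card_union_le (G₁ ∪ G₂)
      ({krow y w 0 A₁, krow y w 0 B₁, krow y w 0 A₂, krow y w 0 B₂} : Finset (ι → F))
    omega
  · exact hΨ₁.affine hA₁ hB₁ (by intro v hv; simp [Finset.mem_coe.mp hv]) (by simp) (by simp)
  · exact hΨ₂.affine hA₂ hB₂ (by intro v hv; simp [Finset.mem_coe.mp hv]) (by simp) (by simp)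

/-- **Sum node**: `KInv s₁ P₁ → KInv s₂ P₂ → KInv (s₁ + s₂) (c₁ P₁ + c₂ P₂)`.
[cite: Kalorkoti1985, §3] -/
theorem KInv.lin [DecidableEq (ι → F)] {s₁ s₂ : ℕ} {P₁ P₂ : MvPolynomial σ F}
    (h₁ : KInv y w s₁ P₁) (h₂ : KInv y w s₂ P₂) (c₁ c₂ : F) :
    KInv y w (s₁ + s₂) (c₁ • P₁ + c₂ • P₂) := by
  rcases h₁ with ⟨rfl, hf₁⟩ | ⟨G₁, A₁, B₁, Ψ₁, hc₁, hA₁, hB₁, hΨ₁, rfl⟩ <;>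
    rcases h₂ with ⟨rfl, hf₂⟩ | ⟨G₂, A₂, B₂, Ψ₂, hc₂, hA₂, hB₂, hΨ₂, rfl⟩
  · exact Or.inl ⟨rfl, hf₁.lin hf₂ c₁ c₂⟩
  · refine Or.inr ⟨G₂, c₂ • A₂, c₁ • P₁ + c₂ • B₂, Ψ₂, by omega, hA₂.smul c₂,
      hf₁.lin hB₂ c₁ c₂, hΨ₂, ?_⟩
    simp only [smul_add, smul_mul_assoc]
    ring
  · refine Or.inr ⟨G₁, c₁ • A₁, c₁ • B₁ + c₂ • P₂, Ψ₁, by omega, hA₁.smul c₁,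
      hB₁.lin hf₂ c₁ c₂, hΨ₁, ?_⟩
    simp only [smul_add, smul_mul_assoc]
    ring
  · obtain ⟨G, hG, hP₁, hP₂⟩ := KInv.merge hc₁ hc₂ hA₁ hB₁ hΨ₁ hA₂ hB₂ hΨ₂
    exact Or.inr ⟨G, 1, 0, c₁ • (A₁ * Ψ₁ + B₁) + c₂ • (A₂ * Ψ₂ + B₂), hG,
      by simpa using YFree.C (F := F) y 1, by simpa using YFree.C (F := F) y 0,
      hP₁.lin hP₂ c₁ c₂, by ring⟩

/-- **Product node**: `KInv s₁ P₁ → KInv s₂ P₂ → KInv (s₁ + s₂) (P₁ P₂)`.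
[cite: Kalorkoti1985, §3] -/
theorem KInv.mul [DecidableEq (ι → F)] {s₁ s₂ : ℕ} {P₁ P₂ : MvPolynomial σ F}
    (h₁ : KInv y w s₁ P₁) (h₂ : KInv y w s₂ P₂) : KInv y w (s₁ + s₂) (P₁ * P₂) := by
  rcases h₁ with ⟨rfl, hf₁⟩ | ⟨G₁, A₁, B₁, Ψ₁, hc₁, hA₁, hB₁, hΨ₁, rfl⟩ <;>
    rcases h₂ with ⟨rfl, hf₂⟩ | ⟨G₂, A₂, B₂, Ψ₂, hc₂, hA₂, hB₂, hΨ₂, rfl⟩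
  · exact Or.inl ⟨rfl, hf₁.mul hf₂⟩
  · exact Or.inr ⟨G₂, P₁ * A₂, P₁ * B₂, Ψ₂, by omega, hf₁.mul hA₂, hf₁.mul hB₂, hΨ₂, by ring⟩
  · exact Or.inr ⟨G₁, A₁ * P₂, B₁ * P₂, Ψ₁, by omega, hA₁.mul hf₂, hB₁.mul hf₂, hΨ₁, by ring⟩
  · obtain ⟨G, hG, hP₁, hP₂⟩ := KInv.merge hc₁ hc₂ hA₁ hB₁ hΨ₁ hA₂ hB₂ hΨ₂
    exact Or.inr ⟨G, 1, 0, (A₁ * Ψ₁ + B₁) * (A₂ * Ψ₂ + B₂), hG,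
      by simpa using YFree.C (F := F) y 1, by simpa using YFree.C (F := F) y 0,
      by simpa using hP₁.mul hP₂, by ring⟩

end inv

/-! ## The theorem: leaf counts bound the rank of the Kalorkoti rows of a formula -/

/-- **Kalorkoti at the origin, invariant form.**  Every weighted fan-in-two formula `e` admits a
leaf count `d` (at most `e.numVars` in total over any finset of variables) such that for every
block variable `y` and columns `w` avoiding `y`, `KInv y w (d y) e.eval` holds.
[cite: Kalorkoti1985, Thm. 1] -/
theorem _root_.Literature.Computability.AlgebraicComplexity.WExpr.exists_leafCount_kInv
    [DecidableEq (ι → F)] (e : WExpr F σ) :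
    ∃ d : σ → ℕ, (∀ s : Finset σ, ∑ y ∈ s, d y ≤ e.numVars) ∧
      ∀ (y : σ) (w : ι → σ), (∀ l, w l ≠ y) → KInv y w (d y) e.eval := by
  classical
  induction e with
  | var i =>
    refine ⟨fun y => if y = i then 1 else 0, fun s => ?_, fun y w hw => ?_⟩
    · rw [WExpr.numVars_var, Finset.sum_ite_eq']
      split_ifs <;> simp
    · by_cases h : y = i
      · subst h
        simpa using KInv.X_self (F := F) hw
      · dsimp only
        rw [if_neg h, WExpr.eval_var]
        exact KInv.of_yFree (YFree.X_of_ne (Ne.symm h))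
  | const c =>
    refine ⟨fun _ => 0, fun s => by simp, fun y w _ => ?_⟩
    rw [WExpr.eval_const]
    exact KInv.of_yFree (YFree.C y c)
  | lin c₁ e₁ c₂ e₂ ih₁ ih₂ =>
    obtain ⟨d₁, hd₁, h₁⟩ := ih₁
    obtain ⟨d₂, hd₂, h₂⟩ := ih₂
    refine ⟨fun y => d₁ y + d₂ y, fun s => ?_, fun y w hw => ?_⟩
    · rw [Finset.sum_add_distrib, WExpr.numVars_lin]
      exact Nat.add_le_add (hd₁ s) (hd₂ s)
    · rw [WExpr.eval_lin]
      exact (h₁ y w hw).lin (h₂ y w hw) c₁ c₂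
  | mul e₁ e₂ ih₁ ih₂ =>
    obtain ⟨d₁, hd₁, h₁⟩ := ih₁
    obtain ⟨d₂, hd₂, h₂⟩ := ih₂
    refine ⟨fun y => d₁ y + d₂ y, fun s => ?_, fun y w hw => ?_⟩
    · rw [Finset.sum_add_distrib, WExpr.numVars_mul]
      exact Nat.add_le_add (hd₁ s) (hd₂ s)
    · rw [WExpr.eval_mul]
      exact (h₁ y w hw).mul (h₂ y w hw)

/-- **Kalorkoti at the origin, rank form.**  For every weighted fan-in-two formula `e` there is a
leaf count `d : σ → ℕ` with `∑_{y ∈ s} d y ≤ e.numVars` for all `s`, such that for every block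
variable `y` and columns `w` avoiding `y` the Kalorkoti rows `krow y w j e.eval`, `j ≥ 1`, all lie
in the span of at most `4 · d y` vectors. [cite: Kalorkoti1985, Thm. 1] -/
theorem _root_.Literature.Computability.AlgebraicComplexity.WExpr.exists_leafCount_krow_mem_span
    (e : WExpr F σ) :
    ∃ d : σ → ℕ, (∀ s : Finset σ, ∑ y ∈ s, d y ≤ e.numVars) ∧
      ∀ (y : σ) (w : ι → σ), (∀ l, w l ≠ y) →
        ∃ G : Finset (ι → F), G.card ≤ 4 * d y ∧
          ∀ j, 1 ≤ j → krow y w j e.eval ∈ Submodule.span F (G : Set (ι → F)) := by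
  classical
  obtain ⟨d, hd, h⟩ := e.exists_leafCount_kInv (ι := ι)
  refine ⟨d, hd, fun y w hw => ?_⟩
  rcases h y w hw with ⟨h0, hf⟩ | ⟨G, A, B, Ψ, hc, hA, hB, hΨ, hP⟩
  · refine ⟨∅, by simp, fun j hj => ?_⟩
    obtain ⟨j, rfl⟩ := Nat.exists_eq_add_of_le' hj
    rw [hf.krow_succ]
    exact Submodule.zero_mem _
  · refine ⟨insert (krow y w 0 A) G, ?_, fun j hj => ?_⟩
    · exact (Finset.card_insert_le _ _).trans (by omega)
    · obtain ⟨j, rfl⟩ := Nat.exists_eq_add_of_le' hj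
      rw [hP, krow_add, hB.krow_succ, add_zero]
      have hAΨ : RowsIn y w (insert (krow y w 0 A) G : Finset (ι → F)) (A * Ψ) :=
        ((hA.rowsIn w).mul hΨ).mono (by
          rintro v (hv | hv)
          · rw [Set.mem_singleton_iff] at hv
            simp [hv]
          · simp [Finset.mem_coe.mp hv])
      exact hAΨ (j + 1)

end Summit.ValiantsHypothesis.ValiantsHypothesis.Theorems.BarrierLever.FormulaSlice

end
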